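import Summits.MatrixMultiplication.MatrixMultiplication.Theorems.SoloInformedCwTwoDoor
import Literature.Computability.AlgebraicComplexity.AsymptoticSubrankDuality
import Literature.Computability.AlgebraicComplexity.DegenerationSpectralMonotone
import Literature.Computability.AlgebraicComplexity.BorderRankDirectSum
import Literature.Computability.AlgebraicComplexity.BorderRankRestriction
import Literature.Computability.AlgebraicComplexity.KoszulYoungCertificate
import Literature.Computability.AlgebraicComplexity.ApproxDecompositionCertificate
import Literature.Barriers.MatrixMultiplication.RectangularBarrier
import Literature.Barriers.MatrixMultiplication.IrreversibilityBarrierProofs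

/-!
# The catalyst door: `R̲(t^{⊠N} ⊕ ⟨m⟩) ≤ m + r ⇒ R̃(t) ≤ r^{1/N}`, and its `N = 1` level for `T_cw,2`

A border-rank bound for a Kronecker power of a tensor DIRECT-SUMMED WITH A CATALYST bounds the
asymptotic rank of the tensor itself, through Strassen duality: every universal spectral point `F`
is additive, multiplicative, takes the value `m` at `⟨m⟩` and is dominated by the border rank, so
`F(t)^N + m = F(t^{⊠N} ⊕ ⟨m⟩) ≤ R̲(t^{⊠N} ⊕ ⟨m⟩)`, and `R̃(t) = max_F F(t)`.  More generally
`R̃(t)^N + Q̃(s) ≤ R̲(t^{⊠N} ⊕ s)` for any catalyst `s` (the subrank duality `Q̃ = min_F F`).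
This is the mechanism of Schönhage's τ-theorem / the Coppersmith–Winograd 1982 catalyst trick
(Landsberg 2017, §3.3), written for a FIXED tensor and the tree's constants `asymptoticRank`,
`asymptoticSubrank`, `algBorderRank`.

Consequences for the small Coppersmith–Winograd tensor (the door `R̃(T_cw,2) ≤ 3 ⇒ ω = 2` of
`SoloInformedCwTwoDoor.lean`):
* `matrixMultiplication_of_cwTensor_two_catalyst` — **door D10**: if for some `N ≥ 1` and `m`,
  `R̲(T_cw,2^{⊠N} ⊕ ⟨m⟩) ≤ m + 3^N`, then `ω = 2`;
* `asymptoticRank_cwTensor_two_le_sqrt_of_catalyst` — the `N = 2` level: `R̲(T_cw,2^{⊠2} ⊕ ⟨m⟩)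
  ≤ m + r ⇒ R̃(T_cw,2) ≤ √r`; with `r = 15` this would give `R̃(T_cw,2) ≤ √15 < 3.9235` (below the
  best bound in print, Alman–Li 2026), although `√15` is useless for `ω` (`4(√15)³/27 > 8 = 2³`);
* the `N = 1` level is CLOSED, in the kernel: `R̲(T_cw,2 ⊕ ⟨1⟩) = 5` and `R̲(T_cw,2 ⊕ T_cw,2) = 8`
  over every field (`p = 1` Koszul–Young certificates with unit pivots, re-checked by `decide`, plus
  subadditivity), so no catalytic saving exists before taking Kronecker powers — an instance of the
  open additivity problem `R̲(T ⊕ ⟨1⟩) = R̲(T) + 1` (Buczyński–Postinghel–Rupniewski 2020, Problem 2,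
  known in dimensions `≤ 4`), here decided for `T = T_cw,2`.

HONEST FRAMING: the door theorems are two-line consequences of duality; the certificates are facts
about explicit `4×4×4` / `6×6×6` tensors.  Nothing here bounds `R̃(T_cw,2)` below `4`; the open
content is a border-rank identity for `T_cw,2^{⊠N} ⊕ ⟨m⟩` with `N ≥ 2` (smallest useful instance:
`R̲(perm₃ ⊕ ⟨m⟩) ≤ 15 + m`, `perm₃ ≅ T_cw,2^{⊠2}`, against the known `15 + m ≤ R̲ ≤ 16 + m`).

[cite: ChristandlVranaZuiddam2023, Prop. 1.6, §1.2]
[cite: LandsbergGCT2017, §3.3 (Schönhage, CW82 catalyst), Thm. 2.2.2.1]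
[cite: BuczynskiPostinghelRupniewski2020, Problem 2, Thm. 3 (arXiv:1902.06582, p. 4)]
[cite: LandsbergOttaviani2015, Thm. 2.1]
[cite: ConnerGesmundoLandsbergVentura2022, p. 3]
-/

noncomputable section

namespace Summit.MatrixMultiplication.MatrixMultiplication.Theorems

open Literature.Computability.AlgebraicComplexity
open Literature.Barriers.MatrixMultiplication (tensorRank_unitTensor_le)
open Literature.LinearAlgebra.Matrix (intTriCheckUnit)

universe u

/-! ## Spectral points on catalysed Kronecker powers -/

/-- `F(t^{⊠N} ⊕ ⟨m⟩) = F(t)^N + m` for every universal spectral point `F`.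
[cite: ChristandlVranaZuiddam2023, §1.2] -/
theorem spectralPoint_kroneckerPow_directSum_unitTensor {F : SpectralMap ℂ}
    (hF : IsUniversalSpectralPoint ℂ F) {ι κ μ : Type} [Fintype ι] [Fintype κ] [Fintype μ]
    (t : ι → κ → μ → ℂ) (N m : ℕ) :
    F (directSumTensor (kroneckerPow t N) (unitTensor ℂ m)) = F t ^ N + m := by
  rw [hF.map_directSum, hF.map_kroneckerPow, hF.map_unitTensor]

/-- **Catalysed border-rank bounds dominate spectral points**: `R̲(t^{⊠N} ⊕ ⟨m⟩) ≤ m + r` with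
`N ≠ 0` forces `F(t) ≤ r^{1/N}` for every universal spectral point `F`.
[cite: ChristandlVranaZuiddam2023, §1.2, Prop. 1.6] -/
theorem spectralPoint_le_rpow_of_catalyst {F : SpectralMap ℂ} (hF : IsUniversalSpectralPoint ℂ F)
    {ι κ μ : Type} [Fintype ι] [Fintype κ] [Fintype μ] [DecidableEq ι] [DecidableEq κ]
    [DecidableEq μ] (t : ι → κ → μ → ℂ) {N : ℕ} (hN : N ≠ 0) {m r : ℕ}
    (h : algBorderRank (directSumTensor (kroneckerPow t N) (unitTensor ℂ m)) ≤ m + r) :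
    F t ≤ (r : ℝ) ^ (N : ℝ)⁻¹ := by
  have h1 : F t ^ N + m ≤ ((m + r : ℕ) : ℝ) := by
    rw [← spectralPoint_kroneckerPow_directSum_unitTensor hF t N m]
    exact hF.le_of_algBorderRank_le _ h
  have h2 : F t ^ N ≤ r := by
    push_cast at h1
    linarith
  calc F t = (F t ^ N) ^ (N : ℝ)⁻¹ := (Real.pow_rpow_inv_natCast (hF.nonneg t) hN).symm
    _ ≤ (r : ℝ) ^ (N : ℝ)⁻¹ :=
      Real.rpow_le_rpow (pow_nonneg (hF.nonneg t) N) h2 (inv_nonneg.2 (Nat.cast_nonneg N))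

/-- **The catalyst door (general tensor)**: `R̲(t^{⊠N} ⊕ ⟨m⟩) ≤ m + r`, `N ≠ 0` ⇒ `R̃(t) ≤ r^{1/N}`
(Strassen duality `R̃ = max_F F`, proved in the tree).
[cite: ChristandlVranaZuiddam2023, Prop. 1.6] [cite: LandsbergGCT2017, §3.3] -/
theorem asymptoticRank_le_rpow_of_catalyst {ι κ μ : Type} [Fintype ι] [Fintype κ] [Fintype μ]
    [DecidableEq ι] [DecidableEq κ] [DecidableEq μ] (t : ι → κ → μ → ℂ) {N : ℕ} (hN : N ≠ 0)
    {m r : ℕ} (h : algBorderRank (directSumTensor (kroneckerPow t N) (unitTensor ℂ m)) ≤ m + r) :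
    asymptoticRank t ≤ (r : ℝ) ^ (N : ℝ)⁻¹ :=
  strassen_duality_asymptoticRank.asymptoticRank_le (strassen_duality_asymptoticRank_holds ℂ) t
    fun _ hF => spectralPoint_le_rpow_of_catalyst hF t hN h

/-- **General catalysts**: `R̃(t)^N + Q̃(s) ≤ R̲(t^{⊠N} ⊕ s)` — a catalyst `s` can save at most
`R̲(t^{⊠N} ⊕ s) - R̃(t)^N ≤ R̲ - Q̃(s)`… i.e. the achievable bound on `R̃(t)^N` is the border rank of
the catalysed power minus the ASYMPTOTIC SUBRANK of the catalyst (both dualities, proved in the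
tree: a point `F` attaining `R̃(t)` has `F(s) ≥ Q̃(s)`).
[cite: ChristandlVranaZuiddam2023, Prop. 1.6] -/
theorem asymptoticRank_pow_add_asymptoticSubrank_le_of_catalyst {ι κ μ ι' κ' μ' : Type}
    [Fintype ι] [Fintype κ] [Fintype μ] [DecidableEq ι] [DecidableEq κ] [DecidableEq μ]
    [Fintype ι'] [Fintype κ'] [Fintype μ'] [DecidableEq ι'] [DecidableEq κ'] [DecidableEq μ']
    (t : ι → κ → μ → ℂ) (s : ι' → κ' → μ' → ℂ) (N : ℕ) :
    asymptoticRank t ^ N + asymptoticSubrank ℂ s ≤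
      (algBorderRank (directSumTensor (kroneckerPow t N) s) : ℝ) := by
  obtain ⟨F, hF, hFt⟩ := (strassen_duality_asymptoticRank_holds ℂ t).2
  have hQ : asymptoticSubrank ℂ s ≤ F s := (strassen_duality_asymptoticSubrank_holds ℂ s).1 F hF
  have hB : F (directSumTensor (kroneckerPow t N) s) ≤
      (algBorderRank (directSumTensor (kroneckerPow t N) s) : ℝ) :=
    hF.le_of_algBorderRank_le _ le_rfl
  rw [hF.map_directSum, hF.map_kroneckerPow, hFt] at hB
  linarith

/-! ## The door for `T_cw,2` -/

/-- **Door D10**: if some Kronecker power of the small Coppersmith–Winograd tensor, catalysed by a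
unit tensor, has border rank `R̲(T_cw,2^{⊠N} ⊕ ⟨m⟩) ≤ m + 3^N` (`N ≥ 1`), then `ω = 2`
(`R̃(T_cw,2) ≤ (3^N)^{1/N} = 3` and the door of `SoloInformedCwTwoDoor.lean`).
[cite: ConnerGesmundoLandsbergVentura2022, p. 3] [cite: ChristandlVranaZuiddam2023, Prop. 1.6] -/
theorem matrixMultiplication_of_cwTensor_two_catalyst
    (h : ∃ N : ℕ, N ≠ 0 ∧ ∃ m : ℕ,
      algBorderRank (directSumTensor (kroneckerPow (cwTensor ℂ 2) N) (unitTensor ℂ m)) ≤ m + 3 ^ N) :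
    _root_.MatrixMultiplication := by
  obtain ⟨N, hN, m, h⟩ := h
  refine matrixMultiplication_of_asymptoticRank_cwTensor_two_le_three ?_
  have key := asymptoticRank_le_rpow_of_catalyst (cwTensor ℂ 2) hN h
  have h3 : ((3 ^ N : ℕ) : ℝ) ^ (N : ℝ)⁻¹ = 3 := by
    push_cast
    exact Real.pow_rpow_inv_natCast (by norm_num) hN
  rwa [h3] at key

/-- **Level `N = 2`**: `R̲(T_cw,2^{⊠2} ⊕ ⟨m⟩) ≤ m + r ⇒ R̃(T_cw,2) ≤ √r` (`T_cw,2^{⊠2} ≅ perm₃`, the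
`S₃`-symmetrised determinant, of border rank `16`; so `r = 15`, a catalytic saving of ONE, is the
first instance with content). [cite: ChristandlVranaZuiddam2023, Prop. 1.6]
[cite: ConnerGesmundoLandsbergVentura2022, Thm. 1.3 (`R̲(perm₃) = 16`)] -/
theorem asymptoticRank_cwTensor_two_le_sqrt_of_catalyst {m r : ℕ}
    (h : algBorderRank (directSumTensor (kroneckerPow (cwTensor ℂ 2) 2) (unitTensor ℂ m)) ≤ m + r) :
    asymptoticRank (cwTensor ℂ 2) ≤ Real.sqrt r := by
  have key := asymptoticRank_le_rpow_of_catalyst (cwTensor ℂ 2) two_ne_zero h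
  have e : ((r : ℕ) : ℝ) ^ ((2 : ℕ) : ℝ)⁻¹ = Real.sqrt r := by
    rw [Real.sqrt_eq_rpow]
    norm_num
  rwa [e] at key

/-- The numbers behind the `N = 2` level: `√15 < 3.9235` (so `R̲(perm₃ ⊕ ⟨m⟩) ≤ 15 + m` would beat
the best upper bound on `R̃(T_cw,2)` in print, `3.9235`, Alman–Li 2026), while `4 (√15)³ / 27 > 8`,
i.e. `log₂(4ρ³/27) > 3` at `ρ = √15`: the Coppersmith–Winograd formula turns `R̃(T_cw,2) ≤ √15`
into NO bound on `ω` below `3`. [cite: ConnerGesmundoLandsbergVentura2022, p. 3] -/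
theorem sqrt_fifteen_numerics :
    Real.sqrt 15 < 3.9235 ∧ (8 : ℝ) < 4 * Real.sqrt 15 ^ 3 / 27 := by
  constructor
  · rw [Real.sqrt_lt' (by norm_num : (0 : ℝ) < 3.9235)]
    norm_num
  · have hs : Real.sqrt 15 ^ 2 = 15 := Real.sq_sqrt (by norm_num)
    have hl : (3.8 : ℝ) < Real.sqrt 15 := by
      rw [Real.lt_sqrt (by norm_num : (0 : ℝ) ≤ 3.8)]
      norm_num
    nlinarith [hs, hl]

/-! ## Level `N = 1` is closed: kernel certificates `R̲(T_cw,2 ⊕ ⟨1⟩) = 5`, `R̲(T_cw,2 ⊕ T_cw,2) = 8` -/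

namespace CatalystCert

/-- `T_cw,2 ⊕ ⟨1⟩` as an integer table in the frame `Fin 4` (indices `0,1,2`: the `T_cw,2` block;
`3`: the unit). [cite: ConnerGesmundoLandsbergVentura2022, eq. (1)] -/
def cwTwoUnitOne : Fin 4 → Fin 4 → Fin 4 → ℤ :=
  ApproxCert.ofEntries 4 4 4
    [((0, 1, 1), 1), ((0, 2, 2), 1), ((1, 0, 1), 1), ((1, 1, 0), 1), ((2, 0, 2), 1), ((2, 2, 0), 1),
      ((3, 3, 3), 1)]

/-- `T_cw,2 ⊕ T_cw,2` as an integer table in the frame `Fin 6` (blocks `{0,1,2}` and `{3,4,5}`).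
[cite: ConnerGesmundoLandsbergVentura2022, eq. (1)] -/
def cwTwoTwice : Fin 6 → Fin 6 → Fin 6 → ℤ :=
  ApproxCert.ofEntries 6 6 6
    [((0, 1, 1), 1), ((0, 2, 2), 1), ((1, 0, 1), 1), ((1, 1, 0), 1), ((2, 0, 2), 1), ((2, 2, 0), 1),
      ((3, 4, 4), 1), ((3, 5, 5), 1), ((4, 3, 4), 1), ((4, 4, 3), 1), ((5, 3, 5), 1), ((5, 5, 3), 1)]

/-- The frame identification `Fin 3 ⊕ Fin 1 ≃ Fin 4`. [folklore] -/
def frameFour : Fin 3 ⊕ Fin 1 ≃ Fin 4 := finSumFinEquiv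

/-- The frame identification `Fin 3 ⊕ Fin 3 ≃ Fin 6`. [folklore] -/
def frameSix : Fin 3 ⊕ Fin 3 ≃ Fin 6 := finSumFinEquiv

/-- The table `cwTwoUnitOne` IS `T_cw,2 ⊕ ⟨1⟩` (over `ℤ`) in the frame `frameFour`. [folklore] -/
theorem cwTwoUnitOne_eq : ∀ x y z : Fin 3 ⊕ Fin 1,
    cwTwoUnitOne (frameFour x) (frameFour y) (frameFour z) =
      directSumTensor (cwTensor ℤ 2) (unitTensor ℤ 1) x y z := by
  decide

/-- The table `cwTwoTwice` IS `T_cw,2 ⊕ T_cw,2` (over `ℤ`) in the frame `frameSix`. [folklore] -/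
theorem cwTwoTwice_eq : ∀ x y z : Fin 3 ⊕ Fin 3,
    cwTwoTwice (frameSix x) (frameSix y) (frameSix z) =
      directSumTensor (cwTensor ℤ 2) (cwTensor ℤ 2) x y z := by
  decide

/-- `p = 1` Koszul–Young certificate for `T_cw,2 ⊕ ⟨1⟩`: restricted along `M = (I₃ | 𝟙)`, the
`12 × 12` flattening has `10` certified independent rows with unit pivots (so `R̲ ≥ ⌈10/2⌉ = 5`).
[cite: LandsbergOttaviani2015, Thm. 2.1] -/
theorem cwTwoUnitOne_kyCheck :
    intTriCheckUnit 10 (KYCert.kyEntry 4 4 4 [[1, 0, 0, 1], [0, 1, 0, 1], [0, 0, 1, 1]] cwTwoUnitOne)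
      [[(0, 1)], [(1, 1)], [(2, 1)], [(3, 1)], [(4, 1)], [(5, 1)], [(1, 1), (6, -1)],
        [(3, 1), (7, -1)], [(9, 1)], [(10, 1)]]
      [1, 0, 6, 3, 2, 9, 5, 7, 8, 4] = true := by
  decide +kernel

/-- `p = 1` Koszul–Young certificate for `T_cw,2 ⊕ T_cw,2`: restricted along `M = (I₃ | I₃)`, the
`18 × 18` flattening has `16` certified independent rows with unit pivots (so `R̲ ≥ 8`).
[cite: LandsbergOttaviani2015, Thm. 2.1] -/
theorem cwTwoTwice_kyCheck :
    intTriCheckUnit 16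
      (KYCert.kyEntry 6 6 6 [[1, 0, 0, 1, 0, 0], [0, 1, 0, 0, 1, 0], [0, 0, 1, 0, 0, 1]] cwTwoTwice)
      [[(0, 1)], [(1, 1)], [(2, 1)], [(3, 1)], [(4, 1)], [(5, 1)], [(6, 1)], [(7, 1)],
        [(1, 1), (8, -1)], [(9, 1)], [(10, 1)], [(4, 1), (11, -1)], [(13, 1)], [(14, 1)], [(16, 1)],
        [(17, 1)]]
      [1, 0, 8, 4, 3, 11, 2, 13, 7, 5, 16, 10, 12, 6, 15, 9] = true := by
  decide +kernel

/-- `5 ≤ R̲` for the table `cwTwoUnitOne`, over every field. [cite: LandsbergOttaviani2015, Thm. 2.1] -/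
theorem five_le_algBorderRank_cwTwoUnitOne (K : Type u) [Field K] :
    5 ≤ algBorderRank (fun i j l => (cwTwoUnitOne i j l : K)) :=
  KYCert.le_algBorderRank_of_kyCheckUnit K _ _ cwTwoUnitOne_kyCheck (by norm_num)

/-- `8 ≤ R̲` for the table `cwTwoTwice`, over every field. [cite: LandsbergOttaviani2015, Thm. 2.1] -/
theorem eight_le_algBorderRank_cwTwoTwice (K : Type u) [Field K] :
    8 ≤ algBorderRank (fun i j l => (cwTwoTwice i j l : K)) :=
  KYCert.le_algBorderRank_of_kyCheckUnit K _ _ cwTwoTwice_kyCheck (by norm_num)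

/-- Casting an integer direct sum entrywise is the direct sum of the casts. [folklore] -/
theorem intCast_directSumTensor (K : Type u) [CommRing K] {ι κ μ ι' κ' μ' : Type}
    (s : ι → κ → μ → ℤ) (t : ι' → κ' → μ' → ℤ) (x : ι ⊕ ι') (y : κ ⊕ κ') (z : μ ⊕ μ') :
    ((directSumTensor s t x y z : ℤ) : K) =
      directSumTensor (fun a b c => (s a b c : K)) (fun a b c => (t a b c : K)) x y z := by
  rcases x with x | x <;> rcases y with y | y <;> rcases z with z | z <;> simp

/-- `T_cw,q` over `ℤ` casts to `T_cw,q` over `K`. [cite: ConnerGesmundoLandsbergVentura2022, eq. (1)] -/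
theorem intCast_cwTensor_fun (K : Type u) [CommRing K] (q : ℕ) :
    (fun a b c => ((cwTensor ℤ q a b c : ℤ) : K)) = cwTensor K q := by
  funext a b c
  simp only [cwTensor_apply]
  split_ifs <;> simp

/-- `⟨n⟩` over `ℤ` casts to `⟨n⟩` over `K`. [folklore] -/
theorem intCast_unitTensor_fun (K : Type u) [CommRing K] (n : ℕ) :
    (fun a b c => ((unitTensor ℤ n a b c : ℤ) : K)) = unitTensor K n := by
  funext a b c
  simp only [unitTensor_apply]
  split_ifs <;> simp

end CatalystCert

open CatalystCert

/-- **`R̲(T_cw,2 ⊕ ⟨1⟩) ≥ 5` over every field** (Koszul–Young certificate, kernel-checked).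
[cite: LandsbergOttaviani2015, Thm. 2.1] [cite: BuczynskiPostinghelRupniewski2020, Problem 2] -/
theorem five_le_algBorderRank_cwTensor_two_directSum_unit (K : Type) [Field K] :
    5 ≤ algBorderRank (directSumTensor (cwTensor K 2) (unitTensor K 1)) := by
  have key := five_le_algBorderRank_cwTwoUnitOne K
  rw [← algBorderRank_reindex frameFour frameFour frameFour
    (fun i j l => (cwTwoUnitOne i j l : K))] at key
  have e : directSumTensor (cwTensor K 2) (unitTensor K 1) =
      fun x y z => (cwTwoUnitOne (frameFour x) (frameFour y) (frameFour z) : K) := by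
    funext x y z
    rw [cwTwoUnitOne_eq, intCast_directSumTensor, intCast_cwTensor_fun, intCast_unitTensor_fun]
  rw [e]
  exact key

/-- **`R̲(T_cw,2 ⊕ T_cw,2) ≥ 8` over every field** (Koszul–Young certificate, kernel-checked).
[cite: LandsbergOttaviani2015, Thm. 2.1] -/
theorem eight_le_algBorderRank_cwTensor_two_directSum_self (K : Type) [Field K] :
    8 ≤ algBorderRank (directSumTensor (cwTensor K 2) (cwTensor K 2)) := by
  have key := eight_le_algBorderRank_cwTwoTwice K
  rw [← algBorderRank_reindex frameSix frameSix frameSix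
    (fun i j l => (cwTwoTwice i j l : K))] at key
  have e : directSumTensor (cwTensor K 2) (cwTensor K 2) =
      fun x y z => (cwTwoTwice (frameSix x) (frameSix y) (frameSix z) : K) := by
    funext x y z
    rw [cwTwoTwice_eq, intCast_directSumTensor, intCast_cwTensor_fun]
  rw [e]
  exact key

/-- **`R̲(T_cw,2 ⊕ ⟨1⟩) = 5 = R̲(T_cw,2) + R̲(⟨1⟩)` over every field**: border rank is additive for
this pair (lower bound: the certificate; upper bound: subadditivity, `R̲(T_cw,2) = 4`, `R̲(⟨1⟩) ≤ 1`).
The instance `T = T_cw,2` of the open additivity problem `R̲(T ⊕ ⟨1⟩) = R̲(T) + 1`.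
[cite: BuczynskiPostinghelRupniewski2020, Problem 2, Thm. 3]
[cite: ConnerGesmundoLandsbergVentura2022, §1 (`R̲(T_cw,q) = q + 2`)] -/
theorem algBorderRank_cwTensor_two_directSum_unit (K : Type) [Field K] :
    algBorderRank (directSumTensor (cwTensor K 2) (unitTensor K 1)) = 5 := by
  refine le_antisymm ?_ (five_le_algBorderRank_cwTensor_two_directSum_unit K)
  calc algBorderRank (directSumTensor (cwTensor K 2) (unitTensor K 1))
      ≤ algBorderRank (cwTensor K 2) + algBorderRank (unitTensor K 1) :=
        algBorderRank_directSumTensor_le_add _ _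
    _ ≤ (2 + 2) + 1 := by
        refine Nat.add_le_add (algBorderRank_cwTensor K le_rfl).le ?_
        exact (algBorderRank_le_tensorRank _).trans (tensorRank_unitTensor_le 1)

/-- **`R̲(T_cw,2 ⊕ T_cw,2) = 8 = 2 R̲(T_cw,2)` over every field.**
[cite: ConnerGesmundoLandsbergVentura2022, §1] [cite: LandsbergOttaviani2015, Thm. 2.1] -/
theorem algBorderRank_cwTensor_two_directSum_self (K : Type) [Field K] :
    algBorderRank (directSumTensor (cwTensor K 2) (cwTensor K 2)) = 8 := by
  refine le_antisymm ?_ (eight_le_algBorderRank_cwTensor_two_directSum_self K)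
  calc algBorderRank (directSumTensor (cwTensor K 2) (cwTensor K 2))
      ≤ algBorderRank (cwTensor K 2) + algBorderRank (cwTensor K 2) :=
        algBorderRank_directSumTensor_le_add _ _
    _ ≤ (2 + 2) + (2 + 2) :=
        Nat.add_le_add (algBorderRank_cwTensor K le_rfl).le (algBorderRank_cwTensor K le_rfl).le

/-- The first Kronecker power is the tensor itself, up to the frame `(Fin 1 → ι) ≃ ι`, also inside a
direct sum: `R̲(t^{⊠1} ⊕ s) = R̲(t ⊕ s)`. [folklore] -/
theorem algBorderRank_directSum_kroneckerPow_one {K : Type u} [Field K] {ι κ μ ι' κ' μ' : Type}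
    [Fintype ι] [Fintype κ] [Fintype μ] [DecidableEq ι] [DecidableEq κ] [DecidableEq μ]
    [Fintype ι'] [Fintype κ'] [Fintype μ'] [DecidableEq ι'] [DecidableEq κ'] [DecidableEq μ']
    (t : ι → κ → μ → K) (s : ι' → κ' → μ' → K) :
    algBorderRank (directSumTensor (kroneckerPow t 1) s) = algBorderRank (directSumTensor t s) := by
  have e : directSumTensor (kroneckerPow t 1) s = fun x y z => directSumTensor t s
      (Equiv.sumCongr (Equiv.funUnique (Fin 1) ι) (Equiv.refl ι') x)
      (Equiv.sumCongr (Equiv.funUnique (Fin 1) κ) (Equiv.refl κ') y)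
      (Equiv.sumCongr (Equiv.funUnique (Fin 1) μ) (Equiv.refl μ') z) := by
    funext x y z
    rcases x with x | x <;> rcases y with y | y <;> rcases z with z | z <;>
      simp [Fin.default_eq_zero]
  rw [e, algBorderRank_reindex]

/-- **Level `N = 1`, `m = 1` of door D10 is false**: `R̲(T_cw,2^{⊠1} ⊕ ⟨1⟩) = 5 > 1 + 3^1`.
(At `N = 1` no unit catalyst helps: Strassen's commutator equations give `R̲(T_cw,2^{⊕n} ⊕ ⟨m⟩) =
4n + m` for all `n, m`; the kernel has the instances `(n,m) = (1,1)` here and `(2,0)` above.)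
[cite: LandsbergGCT2017, Thm. 2.2.2.1] [cite: BuczynskiPostinghelRupniewski2020, Problem 2] -/
theorem not_catalyst_level_one :
    ¬ algBorderRank (directSumTensor (kroneckerPow (cwTensor ℂ 2) 1) (unitTensor ℂ 1)) ≤ 1 + 3 ^ 1 := by
  rw [algBorderRank_directSum_kroneckerPow_one, algBorderRank_cwTensor_two_directSum_unit ℂ]
  norm_num

end Summit.MatrixMultiplication.MatrixMultiplication.Theorems
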